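import Mathlib
import HarnessLib

/-!
# Graded antipodal Harris is *pointwise* on round matroids and on complete graphs

Helper file for crux `stmt-CriticalPhenomena-4575` (`NoHeavyLowerTail`, route `PercNearOneGluingNoHeavy`),
new-inequality factory seat `prim-ineq-gen-1` (gen 12).  Memo:
`run/shared/lean/prim/prim-ineq-gen-1/FINDING-18-graded-harris-modular-cuts.md` §3.

**Background.**  For a matroid `M` on `E` with rank function `r` and a bipartition `(Y, E ∖ Y)` the *level* is the
connectivity function `λ(Y) = r(Y) + r(E ∖ Y) − r(E)`; for an increasing event `𝒜` (a family of subsets of `E`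
containing every spanning set) the *antipodal spin* is `s_𝒜(Y) = [Y ∈ 𝒜] − [E ∖ Y ∈ 𝒜]`.  The *Level Principle* of this
lane (FINDING-17) asserts `∑_{λ(Y) = ℓ} s_𝒜(Y) s_ℬ(Y) ≥ 0` level by level for closure events of single-element
extensions (FINDING-18: it fails for general increasing events).  This file isolates the regime in which the statement
is trivial for *all* events: if `M` is **round** (Oxley, *Matroid Theory* §8.6: `E` is not the union of two proper
flats; equivalently every bipartition has a spanning side) then every single term `s_𝒜(Y) s_ℬ(Y)` is `≥ 0`, so every
weighted or graded sum is.  The cycle matroid of the complete graph `K_n` is round — a graph or its complement is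
connected (`SimpleGraph.connected_or_connected_compl`) — which gives the second half: for the antipodal coupling of
bond percolation on `K_n` (red subgraph `G`, blue subgraph `Gᶜ`) and any two events implied by connectivity, in
particular `[a ↔ v]` and `[b ↔ c]`, the product of antipodal spins is pointwise nonnegative.  (This work, 2026-08-20.)
-/

namespace Summit.CriticalPhenomena.PercolationContinuityZ3.Theorems

namespace GradedHarrisRound

open Finset

section Abstract

variable {α : Type*} [Fintype α] [DecidableEq α]

/-! A "rank function" `r : Finset α → ℕ` is *round* if every bipartition has a side of full rank
(`∀ Y, r Y = r univ ∨ r Yᶜ = r univ`; for the rank function of a matroid: the ground set is not a union of two proper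
flats), and an event `A : Finset (Finset α)` is *spanning-closed* if it contains every set of full rank
(`∀ Y, r Y = r univ → Y ∈ A`; every up-set of flats containing the top flat — e.g. a modular cut, or any monotone
function of the closure — is).  Both are kept as explicit hypotheses below. -/

/-- The antipodal spin of the event `A` at the bipartition `(Y, Yᶜ)`: `[Y ∈ A] − [Yᶜ ∈ A]`. [this work] -/
def spin (A : Finset (Finset α)) (Y : Finset α) : ℤ := (if Y ∈ A then 1 else 0) - (if Yᶜ ∈ A then 1 else 0)

/-- The spin of the complementary bipartition is the opposite spin. [this work] -/
theorem spin_compl (A : Finset (Finset α)) (Y : Finset α) : spin A Yᶜ = -spin A Y := by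
  unfold spin
  rw [compl_compl]
  ring

/-- If `Y ∈ A` then `s_A(Y) ≥ 0`. [this work] -/
theorem spin_nonneg_of_mem (A : Finset (Finset α)) (Y : Finset α) (h : Y ∈ A) : 0 ≤ spin A Y := by
  unfold spin
  rw [if_pos h]
  split_ifs <;> norm_num

/-- If `Yᶜ ∈ A` then `s_A(Y) ≤ 0`. [this work] -/
theorem spin_nonpos_of_compl_mem (A : Finset (Finset α)) (Y : Finset α) (h : Yᶜ ∈ A) : spin A Y ≤ 0 := by
  unfold spin
  rw [if_pos h]
  split_ifs <;> norm_num

/-- **Round ⟹ pointwise.**  For a round rank function and two spanning-closed events, every single antipodal term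
`s_A(Y)·s_B(Y)` is nonnegative. [this work] -/
theorem spin_mul_spin_nonneg_of_round (r : Finset α → ℕ) (hr : ∀ Y : Finset α, r Y = r univ ∨ r Yᶜ = r univ)
    (A B : Finset (Finset α)) (hA : ∀ Y : Finset α, r Y = r univ → Y ∈ A) (hB : ∀ Y : Finset α, r Y = r univ → Y ∈ B)
    (Y : Finset α) : 0 ≤ spin A Y * spin B Y := by
  rcases hr Y with h | h
  · exact mul_nonneg (spin_nonneg_of_mem A Y (hA Y h)) (spin_nonneg_of_mem B Y (hB Y h))
  · exact mul_nonneg_of_nonpos_of_nonpos (spin_nonpos_of_compl_mem A Y (hA Yᶜ h))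
      (spin_nonpos_of_compl_mem B Y (hB Yᶜ h))

/-- **Graded antipodal Harris for round rank functions**: for every grading `lvl` (in particular the connectivity
function `λ(Y) = r(Y) + r(Yᶜ) − r(E)`) and every level `L`, `∑_{lvl(Y) = L} s_A(Y) s_B(Y) ≥ 0`. [this work] -/
theorem sum_level_spin_mul_spin_nonneg_of_round {β : Type*} [DecidableEq β] (r : Finset α → ℕ)
    (hr : ∀ Y : Finset α, r Y = r univ ∨ r Yᶜ = r univ) (A B : Finset (Finset α))
    (hA : ∀ Y : Finset α, r Y = r univ → Y ∈ A) (hB : ∀ Y : Finset α, r Y = r univ → Y ∈ B)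
    (lvl : Finset α → β) (L : β) :
    0 ≤ ∑ Y ∈ (univ : Finset (Finset α)).filter (fun Y => lvl Y = L), spin A Y * spin B Y :=
  sum_nonneg fun Y _ => spin_mul_spin_nonneg_of_round r hr A B hA hB Y

/-- Weighted form: for nonnegative weights `w` (e.g. `t^{λ(Y)}`, `q^{k(Y)+k(Yᶜ)}`), `∑_Y w(Y) s_A(Y) s_B(Y) ≥ 0`.
[this work] -/
theorem sum_weight_spin_mul_spin_nonneg_of_round (r : Finset α → ℕ)
    (hr : ∀ Y : Finset α, r Y = r univ ∨ r Yᶜ = r univ) (A B : Finset (Finset α))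
    (hA : ∀ Y : Finset α, r Y = r univ → Y ∈ A) (hB : ∀ Y : Finset α, r Y = r univ → Y ∈ B)
    (w : Finset α → ℤ) (hw : ∀ Y, 0 ≤ w Y) :
    0 ≤ ∑ Y : Finset α, w Y * (spin A Y * spin B Y) :=
  sum_nonneg fun Y _ => mul_nonneg (hw Y) (spin_mul_spin_nonneg_of_round r hr A B hA hB Y)

end Abstract

section CompleteGraph

open Classical in
/-- Antipodal spin of a property of graphs at the red/blue colouring `(G, Gᶜ)` of the complete graph:
`[P G] − [P Gᶜ]`. [this work] -/
noncomputable def gspin {V : Type*} (P : SimpleGraph V → Prop) (G : SimpleGraph V) : ℤ :=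
  (if P G then 1 else 0) - (if P Gᶜ then 1 else 0)

/-- **Complete graphs (the cycle matroid of `K_n` is round).**  If `P` and `Q` are properties of graphs on a nonempty
vertex set that hold for every connected graph (e.g. increasing events generated by connection events), then for every
red/blue colouring `(G, Gᶜ)` of the edges of the complete graph the antipodal spins satisfy `gspin P G · gspin Q G ≥ 0`
pointwise — hence every graded / weighted antipodal Harris sum on `K_n` is nonnegative. [this work] -/
theorem gspin_mul_gspin_nonneg {V : Type*} [Nonempty V] (P Q : SimpleGraph V → Prop)
    (hP : ∀ G : SimpleGraph V, G.Connected → P G) (hQ : ∀ G : SimpleGraph V, G.Connected → Q G)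
    (G : SimpleGraph V) : 0 ≤ gspin P G * gspin Q G := by
  classical
  unfold gspin
  rcases G.connected_or_connected_compl with h | h
  · have hp : P G := hP G h
    have hq : Q G := hQ G h
    rw [if_pos hp, if_pos hq]
    apply mul_nonneg <;> split_ifs <;> norm_num
  · have hp : P Gᶜ := hP Gᶜ h
    have hq : Q Gᶜ := hQ Gᶜ h
    rw [if_pos hp, if_pos hq]
    apply mul_nonneg_of_nonpos_of_nonpos <;> split_ifs <;> norm_num

/-- The percolation instance: connection events `[a ↔ v]`, `[b ↔ c]` on the complete graph.  For every red/blue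
colouring `(G, Gᶜ)` of `E(K_n)`, `([a ↔_G v] − [a ↔_{Gᶜ} v]) · ([b ↔_G c] − [b ↔_{Gᶜ} c]) ≥ 0`; summing with the
weights `[k(G)+k(Gᶜ) = s]` gives the levelwise antipodal Harris inequality (row HX of the Level Principle) on `K_n`,
and with weights `q^{k(G)+k(Gᶜ)}` its random-cluster form, for every `q > 0`. [this work] -/
theorem reach_gspin_mul_nonneg {V : Type*} [Nonempty V] (a v b c : V) (G : SimpleGraph V) :
    0 ≤ gspin (fun H : SimpleGraph V => H.Reachable a v) G * gspin (fun H : SimpleGraph V => H.Reachable b c) G :=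
  gspin_mul_gspin_nonneg _ _ (fun _ hH => hH.preconnected a v) (fun _ hH => hH.preconnected b c) G

/-- Weighted / graded form on the complete graph: for any finite family of colourings and nonnegative weights. [this work] -/
theorem sum_weight_gspin_mul_nonneg {V : Type*} [Nonempty V] (P Q : SimpleGraph V → Prop)
    (hP : ∀ G : SimpleGraph V, G.Connected → P G) (hQ : ∀ G : SimpleGraph V, G.Connected → Q G)
    (s : Finset (SimpleGraph V)) (w : SimpleGraph V → ℤ) (hw : ∀ G, 0 ≤ w G) :
    0 ≤ ∑ G ∈ s, w G * (gspin P G * gspin Q G) :=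
  Finset.sum_nonneg fun G _ => mul_nonneg (hw G) (gspin_mul_gspin_nonneg P Q hP hQ G)

end CompleteGraph

end GradedHarrisRound

end Summit.CriticalPhenomena.PercolationContinuityZ3.Theorems
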